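import Summits.MatrixMultiplication.OmegaCensus.ThreeSetZ5Z5Cells44
import Summits.MatrixMultiplication.OmegaCensus.ThreeSetZ17Cover446
import Summits.MatrixMultiplication.OmegaCensus.DominoZpZpScaled
import Summits.MatrixMultiplication.OmegaCensus.DominoZpZpConsistAlg
import HarnessLib

/-!
# The census cell `(4,4,6)@289` (`Dih(ℤ₁₇²)`): reduction of a cube symmetric form to a KILLER line datum

ω-census `pub-omega`, family (b3), seat pub-omega-group gen 39.  Framing: lottery ticket; floor = certified bounds/negative ranges.
VALUE: the structural half of the kernel route for the three-set cell `(4,4,6)@289` (hitherto ENGINE ×3, same reduction);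
NOT progress on ω.

**Theorem (`exists_killer_line_of_cube_form_44_card289`).**  Let `|A| = 289`, `Φ : A ↠ ℤ₁₇²`, and let `(W, X, Y, x₀)` be a three-set
cube SYMMETRIC form over `A` with `|W| = |X| = 4`, `|Y| = 6`.  Then for one of the four W-KILLERS `κ₀ … κ₃` (count vectors on `ℤ₁₇`:
`[15,15,16,16]`, `[14,15,16,16]`, `[13,15,16,16]`, `[12,13,16,16]`) there are an `X`-datum `F ∈ compsLit 17 4`, a `Y`-datum `G ≤ 6` and a
hole `s` solving the three-set line identity `Σ_u M_{κ,F}(τ,u) G(u) + [s = τ] = 17` (`lineMat3`).  (The killers admit no such solution —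
`ThreeSetZ17Killers446*.lean` — which closes the cell in `ThreeSetZ17Cells446.lean`.)
*Proof.*  Translate `w₀ ↦ 0`; `W − w₀` spans (`card_eq_one_of_subset_coset`), so a basis change `Φ'` gives `Φ'(W − w₀) = {0, e₁, e₂, c}`,
`c = pt 17 ci`, `ci ∉ {0, 1, 17}` (`Φ'` is injective as `|A| = 289`).  The W-cover (`Z17Cover446.cover446`) supplies a form `ψ = lmap a b ≠ 0`,
a shift `β` and a killer index `k` with `ψ(Φ'(W − w₀)) + β = κ_k` as multisets; translating the form by `t ∈ (ψ∘Φ')⁻¹(β)` and projecting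
along `φ = ψ ∘ Φ'` (`three_set_line_identity`, fibre `|A|/17 = 17`) gives the identity with `W`-datum `κ_k`.
-/

namespace Summit.MatrixMultiplication.OmegaCensus

open Finset ZpZpDomino

namespace Z17Frame446

/-! ## Small facts about `ℤ₁₇` and `ℤ₁₇²` -/

/-- Three pairwise dependent vectors of `ℤ₁₇²` are killed by a common non-zero linear form. [folklore] -/
theorem exists_form_of_dets_eq_zero (u v w : ZMod 17 × ZMod 17)
    (huv : u.1 * v.2 - u.2 * v.1 = 0) (huw : u.1 * w.2 - u.2 * w.1 = 0) (hvw : v.1 * w.2 - v.2 * w.1 = 0) :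
    ∃ ab : ZMod 17 × ZMod 17, ab ≠ 0 ∧ ab.1 * u.1 + ab.2 * u.2 = 0 ∧ ab.1 * v.1 + ab.2 * v.2 = 0 ∧ ab.1 * w.1 + ab.2 * w.2 = 0 := by
  by_cases hu : u = 0
  · by_cases hv : v = 0
    · by_cases hw : w = 0
      · exact ⟨(1, 0), by decide, by simp [hu], by simp [hv], by simp [hw]⟩
      · refine ⟨(w.2, -w.1), ?_, by simp [hu], by simp [hv], by ring⟩
        intro h
        apply hw
        have h1 : w.2 = 0 := by simpa using congrArg Prod.fst h
        have h2 : w.1 = 0 := by simpa using congrArg Prod.snd h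
        exact Prod.ext h2 h1
    · refine ⟨(v.2, -v.1), ?_, by simp [hu], by ring, by linear_combination (-1 : ZMod 17) * hvw⟩
      intro h
      apply hv
      have h1 : v.2 = 0 := by simpa using congrArg Prod.fst h
      have h2 : v.1 = 0 := by simpa using congrArg Prod.snd h
      exact Prod.ext h2 h1
  · refine ⟨(u.2, -u.1), ?_, by ring, by linear_combination (-1 : ZMod 17) * huv, by linear_combination (-1 : ZMod 17) * huw⟩
    intro h
    apply hu
    have h1 : u.2 = 0 := by simpa using congrArg Prod.fst h
    have h2 : u.1 = 0 := by simpa using congrArg Prod.snd h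
    exact Prod.ext h2 h1

/-- A natural number cast to `ℤ₁₇` equals `v` iff its residue is `v.val`. [folklore] -/
theorem natCast_eq_iff_mod (n : ℕ) (v : ZMod 17) : ((n : ZMod 17) = v) ↔ n % 17 = v.val := by
  constructor
  · intro h; rw [← h, ZMod.val_natCast]
  · intro h; apply ZMod.val_injective 17; rw [ZMod.val_natCast, h]

/-- A list `map`ped over `range 17` sums to the `Finset.range 17` sum. [folklore] -/
theorem sum_range17_map (f : ℕ → ℕ) : ((List.range 17).map f).sum = ∑ i ∈ Finset.range 17, f i := by
  simp [List.range_succ, Finset.sum_range_succ, add_assoc]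

/-- Summing over `ZMod 17` is summing over `range 17`. [folklore] -/
theorem sum_zmod17_val (g : ℕ → ℕ) : ∑ v : ZMod 17, g v.val = ∑ i ∈ Finset.range 17, g i :=
  Fin.sum_univ_eq_sum_range (fun i => g i) 17

section Core

variable {A : Type*} [AddCommGroup A] [Fintype A] [DecidableEq A]

/-- All fibres of a surjection onto `ZMod 17` have size `|A| / 17`: `17 · |φ⁻¹(0)| = |A|`. [folklore] -/
theorem sevt_mul_card_fibre (φ : A →+ ZMod 17) (hφ : Function.Surjective φ) :
    17 * (univ.filter fun a : A => φ a = 0).card = Fintype.card A := by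
  classical
  rw [← Finset.card_univ (α := A), Finset.card_eq_sum_card_fiberwise (f := fun a : A => φ a) (s := univ) (t := univ)
    (fun a _ => mem_coe.2 (mem_univ _))]
  rw [Finset.sum_congr rfl fun t _ => card_fibre_eq_of_surjective φ hφ t 0, sum_const, card_univ, ZMod.card, smul_eq_mul]

omit [Fintype A] [DecidableEq A] in
/-- The fibre counts of a finset along `φ : A → ℤ₁₇` sum to its size. [folklore] -/
theorem sum_card_filter_eq (φ : A →+ ZMod 17) (X : Finset A) :
    ∑ v : ZMod 17, (X.filter fun x => φ x = v).card = X.card := by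
  classical
  rw [Finset.card_eq_sum_card_fiberwise (f := fun a : A => φ a) (s := X) (t := univ) (fun a _ => mem_coe.2 (mem_univ _))]

/-- **Core step** (frame ordered): translated symmetric form `(W', X', Y', x₀')` with `W' = {0, a, b, c}` (distinct, non-zero),
`det(Φ a, Φ b) ≠ 0`, `|X'| = 4`, `|Y'| = 6`, `|A| = 289` ⇒ a killer line datum carries a solution of the line identity. [folklore] -/
theorem exists_killer_line_core (hA : Fintype.card A = 289) (Φ : A →+ ZMod 17 × ZMod 17) (hΦ : Function.Surjective Φ)
    {W' X' Y' : Finset A} {x₀' a b c : A} (hWt : W' = {0, a, b, c}) (ha0 : a ≠ 0) (hb0 : b ≠ 0) (hc0 : c ≠ 0)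
    (hab : a ≠ b) (hac : a ≠ c) (hbc : b ≠ c) (hD : (Φ a).1 * (Φ b).2 - (Φ a).2 * (Φ b).1 ≠ 0) (hX : X'.card = 4)
    (hY : Y'.card = 6)
    (t₁ : Set.InjOn (fun p : A × A × A => -p.1 + p.2.1 + p.2.2) ↑(W' ×ˢ X' ×ˢ Y'))
    (t₂ : Set.InjOn (fun p : A × A × A => p.1 - p.2.1 + p.2.2) ↑(W' ×ˢ X' ×ˢ Y'))
    (t₃ : Set.InjOn (fun p : A × A × A => p.1 + p.2.1 - p.2.2) ↑(W' ×ˢ X' ×ˢ Y'))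
    (e₁₂ : Disjoint ((W' ×ˢ X' ×ˢ Y').image fun p : A × A × A => -p.1 + p.2.1 + p.2.2)
      ((W' ×ˢ X' ×ˢ Y').image fun p : A × A × A => p.1 - p.2.1 + p.2.2))
    (e₁₃ : Disjoint ((W' ×ˢ X' ×ˢ Y').image fun p : A × A × A => -p.1 + p.2.1 + p.2.2)
      ((W' ×ˢ X' ×ˢ Y').image fun p : A × A × A => p.1 + p.2.1 - p.2.2))
    (e₂₃ : Disjoint ((W' ×ˢ X' ×ˢ Y').image fun p : A × A × A => p.1 - p.2.1 + p.2.2)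
      ((W' ×ˢ X' ×ˢ Y').image fun p : A × A × A => p.1 + p.2.1 - p.2.2))
    (tcov : ((W' ×ˢ X' ×ˢ Y').image fun p : A × A × A => -p.1 + p.2.1 + p.2.2) ∪
      ((W' ×ˢ X' ×ˢ Y').image fun p : A × A × A => p.1 - p.2.1 + p.2.2) ∪
      ((W' ×ˢ X' ×ˢ Y').image fun p : A × A × A => p.1 + p.2.1 - p.2.2) = univ.erase x₀') :
    ∃ k, k < 4 ∧ ∃ Fl : List ℕ, Fl ∈ ZpZpDomino.compsLit 17 4 ∧ ∃ (G : ZMod 17 → ℕ) (s : ZMod 17), (∀ u, G u ≤ 6) ∧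
      ∀ τ : ZMod 17, (∑ u : ZMod 17, lineMat3 (vecFn ((([[0,0,0,0,0,0,0,0,0,0,0,0,0,0,0,2,2], [0,0,0,0,0,0,0,0,0,0,0,0,0,0,1,1,2], [0,0,0,0,0,0,0,0,0,0,0,0,0,1,0,1,2], [0,0,0,0,0,0,0,0,0,0,0,0,1,1,0,0,2]] : List (List ℕ))).getD k [])) (vecFn Fl) τ u * G u) +
        (if s = τ then 1 else 0) = 17 := by
  classical
  haveI : Fact (Nat.Prime 17) := ⟨by norm_num⟩
  set E := basisEquiv (Φ a) (Φ b) hD with hE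
  set Φ' : A →+ ZMod 17 × ZMod 17 := E.symm.toAddMonoidHom.comp Φ with hΦ'
  have hΦ's : Function.Surjective Φ' := E.symm.surjective.comp hΦ
  have hΦ'a : Φ' a = (1, 0) := by
    show E.symm (Φ a) = _
    rw [AddEquiv.symm_apply_eq]; exact (basisEquiv_one_zero _ _ hD).symm
  have hΦ'b : Φ' b = (0, 1) := by
    show E.symm (Φ b) = _
    rw [AddEquiv.symm_apply_eq]; exact (basisEquiv_zero_one _ _ hD).symm
  have hinj : Function.Injective Φ' :=
    ((Fintype.bijective_iff_surjective_and_card Φ').2 ⟨hΦ's, by rw [hA, Fintype.card_prod, ZMod.card]⟩).1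
  -- the fourth point
  set ci : ℕ := ptIdx 17 (Φ' c) with hcidef
  have hci : ci < 289 := ptIdx_lt 17 _
  have hc' : Φ' c = pt 17 ci := by rw [hcidef, pt_ptIdx]
  have hnot : ¬(ci = 0 ∨ ci = 1 ∨ ci = 17) := by
    rintro (h | h | h)
    · apply hc0; apply hinj; rw [hc', h, map_zero]; simp [pt]
    · apply hbc.symm; apply hinj; rw [hc', h, hΦ'b]; simp [pt]
    · apply hac.symm; apply hinj; rw [hc', h, hΦ'a]; simp [pt]
  obtain ⟨α, β, sh, k, hne, hα, hβ, hsh, hk, hcnt⟩ := Z17Cover446.cover446 ci hci hnot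
  -- the killing line form and the re-translation
  set ψ : ZMod 17 × ZMod 17 →+ ZMod 17 := lmap (α : ZMod 17) (β : ZMod 17) with hψ
  have hψne : (α : ZMod 17) ≠ 0 ∨ (β : ZMod 17) ≠ 0 := by
    rcases hne with h | h
    · left; intro e; apply h
      have := (natCast_eq_iff_mod α 0).1 e
      rw [ZMod.val_zero, Nat.mod_eq_of_lt hα] at this; exact this
    · right; intro e; apply h
      have := (natCast_eq_iff_mod β 0).1 e
      rw [ZMod.val_zero, Nat.mod_eq_of_lt hβ] at this; exact this
  set φ : A →+ ZMod 17 := ψ.comp Φ' with hφ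
  have hφs : Function.Surjective φ := (lmap_surjective_of_ne hψne).comp hΦ's
  have eφ : ∀ x, φ x = ψ (Φ' x) := fun x => rfl
  obtain ⟨t, ht⟩ := hφs (sh : ZMod 17)
  obtain ⟨u₁, u₂, u₃, f₁₂, f₁₃, f₂₃, ucov, cW, cX, cY⟩ := cube_symmetric_form_translate t₁ t₂ t₃ e₁₂ e₁₃ e₂₃ tcov t
  set W'' := W'.image (· + t) with hW''
  set X'' := X'.image (· + t) with hX''
  set Y'' := Y'.image (· + t) with hY''
  have hWtt : W'' = {t, a + t, b + t, c + t} := by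
    rw [hW'', hWt, image_insert, image_insert, image_insert, image_singleton, zero_add]
  -- the W-line datum is the killer `k`
  have hφt : φ t = ((sh : ℕ) : ZMod 17) := ht
  have hφa : φ (a + t) = ((α + sh : ℕ) : ZMod 17) := by
    rw [map_add, ht, eφ, hΦ'a, hψ, lmap_apply]; push_cast; ring
  have hφb : φ (b + t) = ((β + sh : ℕ) : ZMod 17) := by
    rw [map_add, ht, eφ, hΦ'b, hψ, lmap_apply]; push_cast; ring
  have hφc : φ (c + t) = ((α * (ci / 17) + β * (ci % 17) + sh : ℕ) : ZMod 17) := by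
    rw [map_add, ht, eφ, hc', hψ, lmap_apply, pt]; push_cast; ring
  have nt : t ∉ ({a + t, b + t, c + t} : Finset A) := by
    simp only [mem_insert, mem_singleton, not_or]
    refine ⟨fun h => ha0 ?_, fun h => hb0 ?_, fun h => hc0 ?_⟩
    · exact (add_right_cancel ((zero_add t).trans h)).symm
    · exact (add_right_cancel ((zero_add t).trans h)).symm
    · exact (add_right_cancel ((zero_add t).trans h)).symm
  have na : a + t ∉ ({b + t, c + t} : Finset A) := by
    simp only [mem_insert, mem_singleton, not_or]
    exact ⟨fun h => hab (add_right_cancel h), fun h => hac (add_right_cancel h)⟩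
  have nb : b + t ∉ ({c + t} : Finset A) := by
    simp only [mem_singleton]
    exact fun h => hbc (add_right_cancel h)
  have hWc : ∀ v : ZMod 17, (W''.filter fun x => φ x = v).card =
      vecFn ((([[0,0,0,0,0,0,0,0,0,0,0,0,0,0,0,2,2], [0,0,0,0,0,0,0,0,0,0,0,0,0,0,1,1,2], [0,0,0,0,0,0,0,0,0,0,0,0,0,1,0,1,2], [0,0,0,0,0,0,0,0,0,0,0,0,1,1,0,0,2]] : List (List ℕ))).getD k []) v := by
    intro v
    have hv := ZMod.val_lt v
    unfold vecFn
    rw [← hcnt v.val hv, hWtt, card_filter, sum_insert nt, sum_insert na, sum_insert nb, sum_singleton, hφt, hφa, hφb, hφc]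
    simp only [natCast_eq_iff_mod]
    ring
  -- the X-line datum as a list of mass 4
  set Fl : List ℕ := (List.range 17).map (fun n : ℕ => (X''.filter fun x => φ x = ((n : ℕ) : ZMod 17)).card) with hFl
  have hXc : ∀ w : ZMod 17, (X''.filter fun x => φ x = w).card = vecFn Fl w := by
    intro w
    unfold vecFn
    rw [hFl, ZpZpDomino.getD_map_range _ (ZMod.val_lt w), ZMod.natCast_zmod_val]
  have hFlmem : Fl ∈ compsLit 17 4 := by
    refine mem_compsLit 17 4 Fl (by rw [hFl, List.length_map, List.length_range]) ?_
    rw [hFl, sum_range17_map, ← sum_zmod17_val (fun n : ℕ => (X''.filter fun x => φ x = ((n : ℕ) : ZMod 17)).card)]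
    simp only [ZMod.natCast_zmod_val]
    rw [sum_card_filter_eq φ X'', cX, hX]
  -- the Y-line datum and the fibre size
  have hGle : ∀ u : ZMod 17, (Y''.filter fun x => φ x = u).card ≤ 6 := fun u =>
    (card_filter_le _ _).trans (by rw [cY, hY])
  have hK : (univ.filter fun x : A => φ x = 0).card = 17 := by
    have h17 := sevt_mul_card_fibre φ hφs
    rw [hA] at h17
    omega
  have hid : ∀ τ : ZMod 17, (∑ u : ZMod 17, lineMat3 (vecFn ((([[0,0,0,0,0,0,0,0,0,0,0,0,0,0,0,2,2], [0,0,0,0,0,0,0,0,0,0,0,0,0,0,1,1,2], [0,0,0,0,0,0,0,0,0,0,0,0,0,1,0,1,2], [0,0,0,0,0,0,0,0,0,0,0,0,1,1,0,0,2]] : List (List ℕ))).getD k []))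
      (vecFn Fl) τ u * (Y''.filter fun x => φ x = u).card) + (if φ (x₀' + t) = τ then 1 else 0) = 17 := by
    refine lineMat3_identity_of_double_sum fun τ => ?_
    have h0 := ThreeSetNorm.three_set_line_identity φ hφs u₁ u₂ u₃ f₁₂ f₁₃ f₂₃ ucov τ
    simp only [hWc, hXc, hK] at h0
    exact h0
  exact ⟨k, hk, Fl, hFlmem, _, φ (x₀' + t), hGle, hid⟩

end Core

end Z17Frame446

end Summit.MatrixMultiplication.OmegaCensus
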